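import Mathlib
import Literature.Analysis.FluidPDE.Tao2016AveragedNS.ShiftSetCascadeFlows
import Summits.NavierStokesRegularity.NavierStokesRegularity.Theorems.TaoLadderRungTwoFlatCertificateGlueCheckerBoxOn
import HarnessLib

/-!
# Certificate glue on a shift set `𝕊`, XXV-d: THE CHECKER'S FRAME CLAUSES — the variational MATRIX `W = V_h·C` as columns of
  interval boxes, the interval products `Cin·W` and `Cn·(Cin·W) − W`, and the row tests of the Lohner transport clause (C6,
  `|Cin V_h C ξ| ≤ r'` on the `r`-box) and of the approximate-inverse clause (C7, `|(Cn Cin − 1) V_h C ξ| ≤ κI`), with soundness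
  (helper for items stmt-NavierStokesRegularity-22987 `FlatGapCertificatesV2` (crux K_A♭ of route TaoLadderRungTwoFlat) and
  stmt-24295 K_A₂(64); cell harvest/h2-tao-ladder, p1 g15; CHECKER-SPEC-v3 §3 (ii) clauses C6, C7)

The Lohner transport is evaluated as a MATRIX (point frames `C`, `Cin`, `Cn` = dyadic data; `W` column `j` = the variational
polynomial of glue XXV along the THIN direction `C e_j`, an interval column), since an interval evaluation of `Cin (V_h (C ξ))` over
the `ξ`-box would lose the cancellation `Cin V_h C ≈ 1` (wrapping). Linearity of `VPoly` in the direction (`VPoly_add`, `VPoly_smul`)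
gives `VPoly Q p x (C ξ) h = W ξ`; each entry of `Cin·W` (resp. `Cn·(Cin·W) − W`) lies in its rounded interval entry, and
`|Σ_j A c j ξ j| ≤ Σ_j mag(B c j)·r j` for `|ξ| ≤ r`. COST: `n` variational columns per step (the driver; RESULTS.md of p1 g15).

HONEST FRAMING: Tao-type MODEL lattices (Tao 2016 §4/§6 vocabulary, shift-set parametrised); arithmetic soundness lemmas — no
certificate data, nothing certified, no stub closed, nothing about the Navier–Stokes equations.
-/

-- the sub-problem namespace repeats the summit name by design (D-0017)
set_option linter.dupNamespace false

namespace Summit.NavierStokesRegularity.NavierStokesRegularity.Theorems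

open Set Finset Literature.Analysis.FluidPDE Literature.Analysis.FluidPDE.TaoCascade
open Summit.NavierStokesRegularity.NavierStokesRegularity.Theorems.TaylorModelCert
open Summit.NavierStokesRegularity.NavierStokesRegularity.Theorems.TaylorModelReadout

namespace CertificateGlueOn

/-! ### Row tests against entry boxes -/

/-- Exact dyadic `Σ_{j : Fin n} mag(B c j) · w j` for a family of entry boxes. [folklore] -/
def rowMagDot (n : ℕ) (B : ℕ → ℕ → IntervalD) (w : Array Dyad) (c : ℕ) : Dyad :=
  (List.finRange n).foldr (fun (j : Fin n) acc => Dyad.add (Dyad.mul (IntervalD.mag (B c j.val)) (dgetD w j.val)) acc)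
    (Dyad.ofInt 0)

/-- Values of dyadic right folds. [folklore] -/
theorem toReal_foldr_add_mul {τ : Type*} (f g : τ → Dyad) (l : List τ) :
    (l.foldr (fun t acc => Dyad.add (Dyad.mul (f t) (g t)) acc) (Dyad.ofInt 0)).toReal =
      (l.map fun t => (f t).toReal * (g t).toReal).sum := by
  induction l with
  | nil => simp
  | cons t l ih => simp [List.foldr_cons, ih]

/-- The value of `rowMagDot`. [folklore] -/
theorem toReal_rowMagDot (n : ℕ) (B : ℕ → ℕ → IntervalD) (w : Array Dyad) (c : ℕ) :
    (rowMagDot n B w c).toReal = ∑ j : Fin n, (IntervalD.mag (B c j.val)).toReal * (dgetD w j.val).toReal := by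
  unfold rowMagDot
  rw [toReal_foldr_add_mul (fun j : Fin n => IntervalD.mag (B c j.val)) (fun j : Fin n => dgetD w j.val), Fin.sum_univ_def]

/-- **Row bound**: if every entry `A c j` lies in `B c j` and `|ξ j| ≤ w j`, then `|Σ_j A c j ξ j| ≤ rowMagDot n B w c`. [folklore] -/
theorem abs_sum_le_rowMagDot {n : ℕ} {B : ℕ → ℕ → IntervalD} {w : Array Dyad} {A : Fin n → Fin n → ℝ} {c : Fin n}
    (hA : ∀ j : Fin n, IntervalD.mem (A c j) (B c j.val)) {ξ : Fin n → ℝ} (hξ : ∀ j, |ξ j| ≤ dvec (n := n) w j) :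
    |∑ j : Fin n, A c j * ξ j| ≤ (rowMagDot n B w c).toReal := by
  rw [toReal_rowMagDot]
  refine (Finset.abs_sum_le_sum_abs _ _).trans (Finset.sum_le_sum fun j _ => ?_)
  rw [abs_mul]
  exact mul_le_mul (IntervalD.abs_le_mag (hA j)) (hξ j) (abs_nonneg _) ((abs_nonneg _).trans (IntervalD.abs_le_mag (hA j)))

/-- The `c`-th entry `Σ_{d : Fin n} Cin[c][d] · col[d]` of a point-row × interval-column product (rounded). [folklore] -/
def ipvEntry (prec n : ℕ) (Cin : Array (Array Dyad)) (col : Array IntervalD) (c : ℕ) : IntervalD :=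
  sumBoxes prec ((List.finRange n).map fun (d : Fin n) =>
    IntervalD.mulR prec (IntervalD.ofDyad (dmgetD Cin c d.val)) (IntervalD.aget col d.val))

/-- `Σ_d Cin c d · v d ∈ ipvEntry` when `v d ∈ col[d]`. [folklore] -/
theorem mem_ipvEntry (prec : ℕ) {n : ℕ} (Cin : Array (Array Dyad)) {col : Array IntervalD} {v : Fin n → ℝ}
    (hv : ∀ d : Fin n, IntervalD.mem (v d) (IntervalD.aget col d)) (c : Fin n) :
    IntervalD.mem (∑ d : Fin n, dmat (n := n) Cin c d * v d) (ipvEntry prec n Cin col c) := by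
  unfold ipvEntry
  rw [Fin.sum_univ_def]
  exact mem_sumBoxes prec (fun d : Fin n => dmat (n := n) Cin c d * v d)
    (fun (d : Fin n) => IntervalD.mulR prec (IntervalD.ofDyad (dmgetD Cin c d.val)) (IntervalD.aget col d.val))
    (List.finRange n) fun d _ => IntervalD.mem_mulR prec (IntervalD.mem_ofDyad _) (hv d)

/-! ### The variational matrix as interval columns -/

variable {m : ℕ} {Kb Ka : ℤ} {ω : Fin m → ℤ → ℝ} {ε₀ : ℝ} {α : Fin m → Fin m → Fin m → ℤ × ℤ × ℤ → ℝ}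
  {shifts : List (ℤ × ℤ × ℤ)} {prec : ℕ} {coefB : Fin m → ℤ → Fin m → Fin m → ℤ × ℤ × ℤ → IntervalD}

/-- Point boxes of column `j` of a dyadic matrix. [folklore] -/
def colBoxA (n : ℕ) (C : Array (Array Dyad)) (j : ℕ) : Array IntervalD :=
  Array.ofFn fun d : Fin n => IntervalD.ofDyad (dmgetD C d j)

/-- **The columns of `W = V_h C`** as interval boxes: column `j` = Horner table at `H` of the variational jets along the thin
direction `C e_j`, over the state jet table `JETS` (= `jetLevelsA n pqBoxA prec X p`, computed once). [folklore] -/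
def vcolsA (Kb Ka : ℤ) (prec : ℕ) (shifts : List (ℤ × ℤ × ℤ))
    (coefB : Fin m → ℤ → Fin m → Fin m → ℤ × ℤ × ℤ → IntervalD) (p : ℕ) (JETS : Array (Array IntervalD)) (H : IntervalD)
    (C : Array (Array Dyad)) : Array (Array IntervalD) :=
  Array.ofFn fun j : Fin (m * winLen Kb Ka) =>
    IntervalD.polyLevelsA (m * winLen Kb Ka) prec
      (IntervalD.varJetLevelsA (m * winLen Kb Ka) (pqBoxA Kb Ka prec shifts coefB) prec JETS (colBoxA (m * winLen Kb Ka) C j) p)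
      p H

/-- The real variational matrix `W c j = VPoly Q p x (C e_j) u c`. [folklore] -/
noncomputable def wMat {n : ℕ} (Q : (Fin n → ℝ) → (Fin n → ℝ) → Fin n → ℝ) (p : ℕ) (x : Fin n → ℝ)
    (C : Matrix (Fin n) (Fin n) ℝ)
    (u : ℝ) : Matrix (Fin n) (Fin n) ℝ :=
  fun c j => VPoly Q p x (fun d => C d j) u c

/-- **Entries of `W` are enclosed** by the interval columns. [folklore] -/
theorem mem_wMat (hKb : 0 ≤ Kb) (hKa : 1 ≤ Ka) (hnd : shifts.Nodup) (hcoef : CoefBoxOK shifts ε₀ α Kb Ka ω coefB) (p : ℕ)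
    {X : Array IntervalD} (hX : X.size = m * winLen Kb Ka) {x : Fin (m * winLen Kb Ka) → ℝ}
    (hx : ∀ c < m * winLen Kb Ka, IntervalD.mem (rdN x c) (IntervalD.aget X c)) {H : IntervalD} {u : ℝ}
    (hu : IntervalD.mem u H) (C : Array (Array Dyad)) (c j : Fin (m * winLen Kb Ka)) :
    IntervalD.mem (wMat (PQcN shifts.toFinset ε₀ α Kb Ka ω) p x (dmat (n := m * winLen Kb Ka) C) u c j)
      (IntervalD.aget (IntervalD.lget (vcolsA Kb Ka prec shifts coefB p
        (IntervalD.jetLevelsA (m * winLen Kb Ka) (pqBoxA Kb Ka prec shifts coefB) prec X p) H C) j) c) := by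
  unfold vcolsA
  rw [IntervalD.lget_ofFn _ j.isLt]
  have hcol : ∀ d < m * winLen Kb Ka, IntervalD.mem (rdN (fun d' : Fin (m * winLen Kb Ka) => dmat (n := m * winLen Kb Ka) C d' j) d)
      (IntervalD.aget (colBoxA (m * winLen Kb Ka) C j) d) := by
    intro d hd
    unfold colBoxA
    rw [IntervalD.aget_ofFn _ hd, rdN_of_lt _ hd]
    exact IntervalD.mem_ofDyad _
  have h := mem_VPoly_polyLevels (prec := prec) hKb hKa hnd hcoef p hX (by simp [colBoxA]) hx hcol hu c c.isLt
  rw [rdN_of_lt _ c.isLt] at h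
  exact h

/-- **`VPoly` along `C ξ` is the matrix `W` applied to `ξ`** (linearity in the direction). [folklore] -/
theorem VPoly_mulVec {n : ℕ} {Q : (Fin n → ℝ) → (Fin n → ℝ) → Fin n → ℝ} (hQl : ∀ u, IsLinearMap ℝ (Q u))
    (hQr : ∀ v, IsLinearMap ℝ (fun u => Q u v)) (p : ℕ) (x : Fin n → ℝ) (C : Matrix (Fin n) (Fin n) ℝ) (u : ℝ)
    (ξ : Fin n → ℝ) : VPoly Q p x (C.mulVec ξ) u = (wMat Q p x C u).mulVec ξ := by
  have hL : IsLinearMap ℝ (fun v => VPoly Q p x v u) :=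
    ⟨fun v v' => VPoly_add hQl hQr p x v v' u, fun r v => VPoly_smul hQl hQr p x v r u⟩
  have hdec : C.mulVec ξ = ∑ j : Fin n, ξ j • (fun d => C d j) := by
    funext d
    simp only [Matrix.mulVec, dotProduct, Finset.sum_apply, Pi.smul_apply, smul_eq_mul]
    exact Finset.sum_congr rfl fun j _ => mul_comm _ _
  rw [hdec]
  have hsum := map_sum (hL.mk' _) (fun j : Fin n => ξ j • (fun d => C d j)) Finset.univ
  simp only [IsLinearMap.mk'_apply, LinearMap.map_smul] at hsum
  rw [hsum]
  funext c
  simp only [Finset.sum_apply, Pi.smul_apply, smul_eq_mul, Matrix.mulVec, dotProduct, wMat]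
  exact Finset.sum_congr rfl fun j _ => mul_comm _ _

/-! ### C6: the transport clause -/

/-- Entry box `(c, j)` of `Cin · W`. [folklore] -/
def pEntry (prec n : ℕ) (Cin : Array (Array Dyad)) (Wcols : Array (Array IntervalD)) (c j : ℕ) : IntervalD :=
  ipvEntry prec n Cin (IntervalD.lget Wcols j) c

/-- `Cin · W`, tabulated as columns (computed once; read by C6 and C7). [folklore] -/
def pcolsA (prec n : ℕ) (Cin : Array (Array Dyad)) (Wcols : Array (Array IntervalD)) : Array (Array IntervalD) :=
  Array.ofFn fun j : Fin n => Array.ofFn fun c : Fin n => pEntry prec n Cin Wcols c j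

/-- **The C6 test**: `Σ_j mag((Cin W)_{c j}) · r j ≤ r'_c` for every row `c`. [folklore] -/
def checkFrame (n : ℕ) (P : Array (Array IntervalD)) (r r' : Array Dyad) : Bool :=
  (List.range n).all fun c =>
    Dyad.ble (rowMagDot n (fun c j => IntervalD.aget (IntervalD.lget P j) c) r c) (dgetD r' c)

/-- **C6 FROM THE TEST**: the Lohner transport clause `hframe` of glue XVIII/XIX-c/XIX-e for the real data
(`C := dmat C`, `Cin := dmat Cin`, `r := dvec r`, `r' := dvec r'`). [cite: Zgliczynski2002C1Lohner, §3–4 (Lohner-type parallelepiped frames); cell certificate format, checker clauses] -/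
theorem frame_of_checkFrame (hKb : 0 ≤ Kb) (hKa : 1 ≤ Ka) (hnd : shifts.Nodup) (hcoef : CoefBoxOK shifts ε₀ α Kb Ka ω coefB)
    (p : ℕ) {X : Array IntervalD} (hX : X.size = m * winLen Kb Ka) {x : Fin (m * winLen Kb Ka) → ℝ}
    (hx : ∀ c < m * winLen Kb Ka, IntervalD.mem (rdN x c) (IntervalD.aget X c)) {H : IntervalD} {u : ℝ}
    (hu : IntervalD.mem u H) {C Cin : Array (Array Dyad)} {r r' : Array Dyad}
    (h : checkFrame (m * winLen Kb Ka) (pcolsA prec (m * winLen Kb Ka) Cin (vcolsA Kb Ka prec shifts coefB p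
      (IntervalD.jetLevelsA (m * winLen Kb Ka) (pqBoxA Kb Ka prec shifts coefB) prec X p) H C)) r r' = true) :
    ∀ ξ : Fin (m * winLen Kb Ka) → ℝ, (∀ c, |ξ c| ≤ dvec (n := m * winLen Kb Ka) r c) →
      ∀ c, |(dmat (n := m * winLen Kb Ka) Cin).mulVec (VPoly (PQcN shifts.toFinset ε₀ α Kb Ka ω) p x
        ((dmat (n := m * winLen Kb Ka) C).mulVec ξ) u) c| ≤ dvec (n := m * winLen Kb Ka) r' c := by
  set n := m * winLen Kb Ka with hn
  set Q := PQcN shifts.toFinset ε₀ α Kb Ka ω with hQ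
  set Wcols := vcolsA Kb Ka prec shifts coefB p (IntervalD.jetLevelsA n (pqBoxA Kb Ka prec shifts coefB) prec X p) H C
    with hW
  intro ξ hξ c
  simp only [checkFrame, List.all_eq_true, List.mem_range, Dyad.ble_iff] at h
  rw [VPoly_mulVec isLinearMap_PQcN_right isLinearMap_PQcN_left, Matrix.mulVec_mulVec]
  have hrow := h c c.isLt
  simp only [Matrix.mulVec, dotProduct]
  refine (abs_sum_le_rowMagDot (B := fun c j => IntervalD.aget (IntervalD.lget (pcolsA prec n Cin Wcols) j) c)
    (fun j => ?_) hξ).trans (by simpa [dvec] using hrow)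
  -- entry `(c, j)` of `Cin * W` lies in its box
  unfold pcolsA
  rw [IntervalD.lget_ofFn _ j.isLt, IntervalD.aget_ofFn _ c.isLt]
  unfold pEntry
  simp only [Matrix.mul_apply]
  exact mem_ipvEntry prec Cin (fun d => mem_wMat hKb hKa hnd hcoef p hX hx hu C d j) c

/-! ### C7: the approximate-inverse clause -/

/-- Entry box `(c, j)` of `Cn · (Cin W) − W`. [folklore] -/
def qEntry (prec n : ℕ) (Cn : Array (Array Dyad)) (P Wcols : Array (Array IntervalD)) (c j : ℕ) : IntervalD :=
  IntervalD.subR prec (ipvEntry prec n Cn (IntervalD.lget P j) c) (IntervalD.aget (IntervalD.lget Wcols j) c)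

/-- **The C7 test**: `Σ_j mag((Cn Cin W − W)_{c j}) · r j ≤ κI` for every row `c`. [folklore] -/
def checkKappa (prec n : ℕ) (Cn : Array (Array Dyad)) (P Wcols : Array (Array IntervalD)) (r : Array Dyad) (κI : Dyad) : Bool :=
  (List.range n).all fun c => Dyad.ble (rowMagDot n (qEntry prec n Cn P Wcols) r c) κI

/-- **C7 FROM THE TEST**: the approximate-inverse clause `hinv` of glue XVIII-b/XIX-c/XIX-e for the real data
(`Cn := dmat Cn`, `κI := κI.toReal`). [cite: Zgliczynski2002C1Lohner, §3–4 (Lohner-type parallelepiped frames); cell certificate format, checker clauses] -/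
theorem kappa_of_checkKappa (hKb : 0 ≤ Kb) (hKa : 1 ≤ Ka) (hnd : shifts.Nodup) (hcoef : CoefBoxOK shifts ε₀ α Kb Ka ω coefB)
    (p : ℕ) {X : Array IntervalD} (hX : X.size = m * winLen Kb Ka) {x : Fin (m * winLen Kb Ka) → ℝ}
    (hx : ∀ c < m * winLen Kb Ka, IntervalD.mem (rdN x c) (IntervalD.aget X c)) {H : IntervalD} {u : ℝ}
    (hu : IntervalD.mem u H) {C Cin Cn : Array (Array Dyad)} {r : Array Dyad} {κI : Dyad}
    (h : checkKappa prec (m * winLen Kb Ka) Cn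
      (pcolsA prec (m * winLen Kb Ka) Cin (vcolsA Kb Ka prec shifts coefB p
        (IntervalD.jetLevelsA (m * winLen Kb Ka) (pqBoxA Kb Ka prec shifts coefB) prec X p) H C))
      (vcolsA Kb Ka prec shifts coefB p
        (IntervalD.jetLevelsA (m * winLen Kb Ka) (pqBoxA Kb Ka prec shifts coefB) prec X p) H C) r κI = true) :
    ∀ ξ : Fin (m * winLen Kb Ka) → ℝ, (∀ c, |ξ c| ≤ dvec (n := m * winLen Kb Ka) r c) → ∀ c,
      |((dmat (n := m * winLen Kb Ka) Cn).mulVec ((dmat (n := m * winLen Kb Ka) Cin).mulVec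
          (VPoly (PQcN shifts.toFinset ε₀ α Kb Ka ω) p x ((dmat (n := m * winLen Kb Ka) C).mulVec ξ) u)) -
        VPoly (PQcN shifts.toFinset ε₀ α Kb Ka ω) p x ((dmat (n := m * winLen Kb Ka) C).mulVec ξ) u) c| ≤ κI.toReal := by
  set n := m * winLen Kb Ka with hn
  set Q := PQcN shifts.toFinset ε₀ α Kb Ka ω with hQ
  set Wcols := vcolsA Kb Ka prec shifts coefB p (IntervalD.jetLevelsA n (pqBoxA Kb Ka prec shifts coefB) prec X p) H C
    with hW
  set P := pcolsA prec n Cin Wcols with hP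
  intro ξ hξ c
  simp only [checkKappa, List.all_eq_true, List.mem_range, Dyad.ble_iff] at h
  have hrow := h c c.isLt
  rw [VPoly_mulVec isLinearMap_PQcN_right isLinearMap_PQcN_left, Matrix.mulVec_mulVec, Matrix.mulVec_mulVec,
    ← Matrix.sub_mulVec, Matrix.mul_assoc]
  simp only [Matrix.mulVec, dotProduct]
  refine (abs_sum_le_rowMagDot (B := qEntry prec n Cn P Wcols) (fun j => ?_) hξ).trans hrow
  -- entry `(c, j)` of `Cn * (Cin * W) - W` lies in its box
  unfold qEntry
  rw [Matrix.sub_apply, Matrix.mul_apply]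
  refine IntervalD.mem_subR prec ?_ (mem_wMat hKb hKa hnd hcoef p hX hx hu C c j)
  refine mem_ipvEntry prec Cn (fun d => ?_) c
  rw [Matrix.mul_apply, hP]
  unfold pcolsA
  rw [IntervalD.lget_ofFn _ j.isLt, IntervalD.aget_ofFn _ d.isLt]
  exact mem_ipvEntry prec Cin (fun e => mem_wMat hKb hKa hnd hcoef p hX hx hu C e j) d

end CertificateGlueOn

end Summit.NavierStokesRegularity.NavierStokesRegularity.Theorems
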